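import Summits.QuantumFields.QCD.Theses.PauliWegnerSea

/-!
# Sketch — crux-ideate round 1, ideator 2, crux `stmt-QuantumFields-17498`
(`Summit.QuantumFields.QCD.Theses.PauliWegnerSea.ChiralGluonicCompletion`, shared with
`WilsonMobilityGap.ChiralGluonicCompletion`).

First lemmas of the two idea cards `strongly-chiral-subsequence` and `parity-at-diverging-volume`.
Everything is stated over tree declarations; proofs marked `sorry` are NOT claimed (crux-ideate stage),
the arithmetic lemma `parity_dilution` and the two one-line logical lemmas are proved.
-/

noncomputable section

namespace Summit.QuantumFields.QCD.Cruxes.ChiralGluonicCompletion.Ideator2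

open MeasureTheory Filter Topology
open Literature.MathematicalPhysics.QuantumFieldTheory Literature.MathematicalPhysics.QuantumLattice
  Literature.Probability.LatticeModels

variable {Nf : ℕ}

/-! ## Card 1 — `strongly-chiral-subsequence` -/

/-- The regularisation along a subsequence `φ` (all data composed with `φ`); same construction as
`Cruxes/GluonicCompletion/Disproof.lean` §6 `subseq`, along which every clause of the hypothesis
package is hereditary. -/
def subseq (reg : QCDRegularisation Nf) (φ : ℕ → ℕ) (hφ : StrictMono φ) : QCDRegularisation Nf where
  a := reg.a ∘ φ
  a_pos k := reg.a_pos (φ k)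
  tendsto_a := reg.tendsto_a.comp hφ.tendsto_atTop
  β := reg.β ∘ φ
  L := reg.L ∘ φ
  tendsto_L := reg.tendsto_L.comp hφ.tendsto_atTop
  mcrit := reg.mcrit ∘ φ
  Zm := reg.Zm ∘ φ
  Zm_pos k := reg.Zm_pos (φ k)

/-- "The pair `(A, B)` violates the lattice-gap inequality of rate `ε` with constant `C` at step `k`"
(on some torus at least the scheme's, at some Euclidean time `n ≤ S`), for the HONEST signed lattice
theory of `reg` at renormalised masses `m` (`z = shift = 0`, as `IsChiralAtZero` reads it). -/
def Violates (reg : QCDRegularisation Nf) (m : Fin Nf → ℝ) (ε C : ℝ) {R R' : ℕ}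
    (A : QCDLatticeObservable Nf R) (B : QCDLatticeObservable Nf R') (k : ℕ) : Prop :=
  ∃ S : ℕ, reg.L k ≤ S ∧ ∃ n : ℕ, n ≤ S ∧
    C * Real.exp (-(ε * (reg.a k * n))) <
      ‖qcdLatticeConnectedCorr (reg.β k) (2 * S + 1) (fun fl => reg.mcrit k + reg.a k * m fl / reg.Zm k) A B n‖

/-- **The statement's pin, unfolded**: `reg.IsChiralAtZero` says that for every `ε > 0` some positive
mass tuple and some pair `(A, B)` violate rate `ε` FREQUENTLY in `k` (for every constant `C`). -/
theorem isChiralAtZero_iff_frequently (reg : QCDRegularisation Nf) :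
    reg.IsChiralAtZero ↔ ∀ ε > (0 : ℝ), ∃ m : Fin Nf → ℝ, (∀ f, 0 < m f) ∧
      ∃ (R R' : ℕ) (A : QCDLatticeObservable Nf R) (B : QCDLatticeObservable Nf R'),
        ∀ C : ℝ, ∃ᶠ k in atTop, Violates reg m ε C A B k := by
  unfold QCDRegularisation.IsChiralAtZero QCDScheme.HasLatticeMassGap Violates
  simp only [not_forall, not_exists, Filter.not_eventually, not_le, exists_prop, gt_iff_lt]
  rfl

/-- **Strong (cofinite) chirality at zero**: as the pin, but the violation holds for ALL large `k`.
This is what Goldstone physics gives for any honestly constructed chiral regularisation (the charged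
pion correlator at small `m` decays slower than `ε` at every fine enough spacing), and — unlike the
pin — it is hereditary under subsequences. -/
def IsStronglyChiralAtZero (reg : QCDRegularisation Nf) : Prop :=
  ∀ ε > (0 : ℝ), ∃ m : Fin Nf → ℝ, (∀ f, 0 < m f) ∧
    ∃ (R R' : ℕ) (A : QCDLatticeObservable Nf R) (B : QCDLatticeObservable Nf R'),
      ∀ C : ℝ, ∀ᶠ k in atTop, Violates reg m ε C A B k

/-- Strong chirality implies the statement's pin. -/
theorem isChiralAtZero_of_strong (reg : QCDRegularisation Nf) (h : IsStronglyChiralAtZero reg) :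
    reg.IsChiralAtZero := by
  rw [isChiralAtZero_iff_frequently]
  intro ε hε
  obtain ⟨m, hm, R, R', A, B, hAB⟩ := h ε hε
  exact ⟨m, hm, R, R', A, B, fun C => (hAB C).frequently⟩

/-- **Heredity.** Strong chirality passes to every subsequence (`∀ᶠ` along `atTop` is preserved by
`StrictMono.tendsto_atTop`); the pin (`∃ᶠ`) does not — see the card for the interleaving witness. -/
theorem stronglyChiral_subseq (reg : QCDRegularisation Nf) (φ : ℕ → ℕ) (hφ : StrictMono φ)
    (h : IsStronglyChiralAtZero reg) : IsStronglyChiralAtZero (subseq reg φ hφ) := by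
  intro ε hε
  obtain ⟨m, hm, R, R', A, B, hAB⟩ := h ε hε
  exact ⟨m, hm, R, R', A, B, fun C => hφ.tendsto_atTop.eventually (hAB C)⟩

/-- **Selection lemma (First lemma of card 1; provable now — Bolzano–Weierstrass diagonal on the
Hilbert cube + heredity).** If `reg` has a strongly chiral subsequence `φ₀`, then for ANY countable
family of bounded real sequences `u i` (the lattice Schwinger functionals the completion wants to
converge — at the scheme volume, a countable dense set of test data and of mass tuples) there is a
further subsequence `φ = φ₀ ∘ ψ` along which every `u i` converges AND the regularisation is (strongly,
hence weakly) chiral at zero. Without the strong hypothesis the conclusion is false in general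
(card: FIP counter-model). -/
theorem chiral_selection (reg : QCDRegularisation Nf) (φ₀ : ℕ → ℕ) (hφ₀ : StrictMono φ₀)
    (h : IsStronglyChiralAtZero (subseq reg φ₀ hφ₀)) (u : ℕ → ℕ → ℝ) (hu : ∀ i k, |u i k| ≤ 1) :
    ∃ (φ : ℕ → ℕ) (hφ : StrictMono φ), (∃ ψ : ℕ → ℕ, StrictMono ψ ∧ φ = φ₀ ∘ ψ) ∧
      (∀ i, ∃ l : ℝ, Tendsto (fun k => u i (φ k)) atTop (𝓝 l)) ∧
        (subseq reg φ hφ).IsChiralAtZero := by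
  -- the bounded sequences as ONE sequence in the Hilbert cube `ℕ → [-1, 1]` along `φ₀`
  let v : ℕ → (ℕ → Set.Icc (-1 : ℝ) 1) := fun k i => ⟨u i (φ₀ k), abs_le.mp (hu i (φ₀ k))⟩
  -- compact + first countable ⇒ sequentially compact: extract a convergent subsequence
  obtain ⟨l, -, ψ, hψ, hl⟩ := (isCompact_univ (X := ℕ → Set.Icc (-1 : ℝ) 1)).isSeqCompact
    (fun k => Set.mem_univ (v k))
  refine ⟨φ₀ ∘ ψ, hφ₀.comp hψ, ⟨ψ, hψ, rfl⟩, fun i => ⟨(l i : ℝ), ?_⟩, ?_⟩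
  · have h1 : Tendsto (fun k => (v (ψ k)) i) atTop (𝓝 (l i)) :=
      (continuous_apply i).continuousAt.tendsto.comp hl
    have h2 : Tendsto (fun k => ((v (ψ k)) i : ℝ)) atTop (𝓝 (l i : ℝ)) :=
      (continuous_subtype_val).continuousAt.tendsto.comp h1
    exact h2
  · exact isChiralAtZero_of_strong _ (stronglyChiral_subseq (subseq reg φ₀ hφ₀) ψ hψ h)

/-- Clause (iii) of the hypothesis package with its constants EXPOSED (body verbatim from the route
file): the phase-quenched fractional moment of the flavour-`f` quark propagator along the time axis is
bounded BELOW by `c₀ e^{−C₁ a_k n} (n+1)^{−p}` on all tori `S ≥ L_k`, eventually in `k`. -/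
def ClauseIIIWith (reg : QCDRegularisation Nf) (m : Fin Nf → ℝ) (s c₀ C₁ p : ℝ) : Prop :=
  ∀ᶠ k in atTop, ∀ S : ℕ, reg.L k ≤ S → ∀ (f : Fin Nf) (n : ℕ), n ≤ S → c₀ * Real.exp (-(C₁ * (reg.a k * n) + p * Real.log (n + 1))) ≤ (∫ U : GaugeConfig 4 (2 * S + 1) (Matrix.specialUnitaryGroup (Fin 3) ℂ), ‖(diracMatrix U fun fl => reg.mcrit k + reg.a k * m fl / reg.Zm k).det‖ * (∑ a : Fin 3, ∑ i : Fin 4, ∑ b : Fin 3, ∑ j : Fin 4, ‖(diracMatrix U fun fl => reg.mcrit k + reg.a k * m fl / reg.Zm k)⁻¹ (quarkEquiv (f, (Torus.proj (2 * S + 1) 0, a, i))) (quarkEquiv (f, (Torus.proj (2 * S + 1) (Pi.single 0 (n : ℤ)), b, j)))‖) ^ s ∂(wilsonMeasure (fundamentalRep (Fin 3)) (reg.β k))) / (∫ U : GaugeConfig 4 (2 * S + 1) (Matrix.specialUnitaryGroup (Fin 3) ℂ), ‖(diracMatrix U fun fl => reg.mcrit k + reg.a k * m fl / reg.Zm k).det‖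 ∂(wilsonMeasure (fundamentalRep (Fin 3)) (reg.β k)))

/-- **The engine in the hypothesis' own currency (stub of the line, NOT provable from H alone):
phase-quenched fractional-moment chirality along a subsequence.** Along some subsequence `φ₀`, for
every `ε > 0` some positive mass tuple carries the clause-(iii) lower bound with exponential rate
`C₁ ≤ ε` and NO logarithmic loss (`p = 0`): the quark-line lower rate closes with the mass. For an
honest mobility-gap witness this is `m_π(m) → 0` read through `E₊[C_π(U;x)^{s/2}]`; it fails along the
offset half of an interleaved regularisation, which is why it is asked along a subsequence. -/
def FMChiralAlong (reg : QCDRegularisation Nf) (φ₀ : ℕ → ℕ) (hφ₀ : StrictMono φ₀) : Prop :=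
  ∀ ε > (0 : ℝ), ∃ m : Fin Nf → ℝ, (∀ f, 0 < m f) ∧ ∃ s c₀ C₁ : ℝ, 0 < s ∧ s < 1 ∧ 0 < c₀ ∧ C₁ ≤ ε ∧
    ClauseIIIWith (subseq reg φ₀ hφ₀) m s c₀ C₁ 0

/-! ## Card 2 — `parity-at-diverging-volume` -/

/-- **Parity dilution (First lemma of card 2; proved).** If a product of `M ≥ 1` block sign-averages
`r ∈ [0,1]` is at least `½` — clause (iv) at the scheme's own torus, whose block count `M = M_k → ∞`,
under block-parity independence (`Negative.SignRatio`'s `blocks_signRatio_eq_pow`) — then each block's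
parity defect `1 − r = 2·P(block parity odd)` is at most `log 2 / M`. -/
theorem parity_dilution {r : ℝ} {M : ℕ} (hM : 1 ≤ M) (h0 : 0 ≤ r)
    (h : (1 / 2 : ℝ) ≤ r ^ M) : 1 - r ≤ Real.log 2 / M := by
  have hMpos : (0 : ℝ) < M := by exact_mod_cast hM
  have hrpos : 0 < r := by
    rcases h0.lt_or_eq with hr | hr
    · exact hr
    · exfalso
      rw [← hr, zero_pow (by omega)] at h
      norm_num at h
  -- log (1/2) ≤ M * log r
  have hlog : Real.log (1 / 2) ≤ (M : ℝ) * Real.log r := by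
    have := Real.log_le_log (by norm_num) h
    rwa [Real.log_pow] at this
  have hlog2 : -Real.log 2 ≤ (M : ℝ) * Real.log r := by
    have : Real.log (1 / 2 : ℝ) = -Real.log 2 := by
      rw [one_div, Real.log_inv]
    linarith [this ▸ hlog]
  -- log r ≤ r - 1
  have hr1 : Real.log r ≤ r - 1 := Real.log_le_sub_one_of_pos hrpos
  have hkey : (M : ℝ) * (1 - r) ≤ Real.log 2 := by nlinarith
  rw [le_div_iff₀ hMpos]
  linarith [hkey]

/-- **Translation-invariant union bound (mechanism statement; trivially proved).** For a finite family
of defect counts `N x` (`x` ranging over the block positions of the torus) with equal expectations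
(translation invariance of the phase-quenched measure and covariance of the defect field), the
probability of a defect at the origin block is at most the expected TOTAL count divided by the number
of blocks — so an `O(1)` total count on a torus of `M_k → ∞` blocks is local rarity `p_k ≤ C / M_k`. -/
theorem localRarity_of_count {X : Type*} [MeasurableSpace X] (μ : Measure X) [IsProbabilityMeasure μ]
    {Λ : Type*} [Fintype Λ] [Nonempty Λ] (N : Λ → X → ℕ)
    (x₀ : Λ) (hti : ∀ x, ∫ ω, (N x ω : ℝ) ∂μ = ∫ ω, (N x₀ ω : ℝ) ∂μ)
    (hint : ∀ x, Integrable (fun ω => (N x ω : ℝ)) μ) :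
    (μ {ω | 1 ≤ N x₀ ω}).toReal ≤ (∫ ω, (∑ x, (N x ω : ℝ)) ∂μ) / Fintype.card Λ := by
  classical
  have hcard : (0 : ℝ) < Fintype.card Λ := by exact_mod_cast Fintype.card_pos
  -- Markov at level 1 for the origin block
  have hmarkov : (μ {ω | 1 ≤ N x₀ ω}).toReal ≤ ∫ ω, (N x₀ ω : ℝ) ∂μ := by
    have h := mul_meas_ge_le_integral_of_nonneg (μ := μ) (f := fun ω => (N x₀ ω : ℝ))
      (Eventually.of_forall fun ω => by positivity) (hint x₀) 1
    have hset : {ω | (1 : ℝ) ≤ (N x₀ ω : ℝ)} = {ω | 1 ≤ N x₀ ω} := by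
      ext ω; simp [Nat.one_le_cast]
    rw [one_mul, hset] at h
    simpa [Measure.real] using h
  -- translation invariance: the total expected count is `card Λ` times the origin's
  have hsum : ∫ ω, (∑ x, (N x ω : ℝ)) ∂μ = Fintype.card Λ * ∫ ω, (N x₀ ω : ℝ) ∂μ := by
    rw [integral_finsetSum _ fun x _ => hint x]
    simp [hti, Finset.sum_const, Finset.card_univ, nsmul_eq_mul]
  rw [hsum, le_div_iff₀ hcard]
  nlinarith [hmarkov, hcard]

end Summit.QuantumFields.QCD.Cruxes.ChiralGluonicCompletion.Ideator2
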